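import Literature.Analysis.FluidPDE.MildL3Restart
import HarnessLib

/-!
# Mild `C([0,T); L³)` solutions tested against caloric fields `e^{νσΔ}φ`

Analysis/FluidPDE proof file (no definitions, no named facts). For an unforced mild solution
`v` on `[0, T)` from `u₀ ∈ L³` in the tree's duality form (`Fluid.IsMildNSSolutionOn (Ico 0 T)`:
for smooth compactly supported divergence-free `φ`,
`⟨v(t), φ⟩ = ⟨u₀, e^{νtΔ}φ⟩ + ∫₀ᵗ ⟨v ⊗ v, ∇e^{ν(t-τ)Δ}φ⟩ dτ`) with `v ∈ C([0,T); L³)` jointly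
measurable, on a three-dimensional space, the identity from the datum at a time `s ∈ [0, T)`
extends to the **caloric test field** `ψ = e^{νσΔ}φ`, `σ ≥ 0`:

  `⟨v(s), e^{νσΔ}φ⟩ = ⟨u₀, e^{ν(s+σ)Δ}φ⟩ + ∫₀ˢ ⟨v ⊗ v, ∇e^{ν(s+σ-τ)Δ}φ⟩ dτ`

(`IsMildNSSolutionOn.integral_inner_heatTest_eq_of_continuousInLpOn_three`; Fabes–Jones–Rivière
1972, Thm. 2.1; Lemarié-Rieusset 2016, Thm. 6.1 with Prop. 6.5: in the classes used, very weak
solutions are Oseen solutions). This is exactly "Step A" of the tree's restart theorem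
`IsMildNSSolutionOn.isMildNSSolutionBetween_of_continuousInLpOn_three` (`MildL3Restart.lean`),
whose proof is followed verbatim — solenoidal truncations `Ψ_R` of `ψ`
(`Fluid.solenoidalTruncation`), the `L³` tails of `v(s)` and of `e^{νsΔ}u₀` against the
`L^{3/2}`-bounded truncation error (`tendsto_integral_inner_solenoidalTruncation`, symmetry of
the heat semigroup `integral_inner_heatExtension_comm`), and the gradient smoothing bound for
the nonlinear terms (`tendsto_eLpNorm_solenoidalTruncation_sub`) — with one difference: there
the caloric time is `σ = t - s` with `t < T`, here `σ ≥ 0` is **arbitrary**, so that `s + σ`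
may exceed the lifespan `T`. This is the form consumed by the gluing of a restarted solution
past the lifespan (the named fact `mild_L3_caloric_test` of `KatoContinuation.lean`, which this
theorem discharges: `mild_L3_caloric_test_holds`, `KatoContinuationProofs.lean`). The only new
ingredient is the time-integrability of the Duhamel pairing
`τ ↦ ∫⟪a(τ), D(e^{ν(t-τ)Δ}φ) b(τ)⟫` on a window `[0, s]` with `s ≤ t` decoupled from the caloric
origin `t` (`intervalIntegrable_transportPairing_of_le`, the tree's
`intervalIntegrable_transportPairing` being the case `s = t`).

## References

* E. B. Fabes, B. F. Jones, N. M. Rivière, *The initial value problem for the Navier–Stokes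
  equations with data in `L^p`*, Arch. Rational Mech. Anal. 45 (1972) 222–240, Thm. 2.1.
  [FabesJonesRiviere1972]
* P. G. Lemarié-Rieusset, *The Navier–Stokes Problem in the 21st Century*, CRC Press 2016,
  doi:10.1201/b19556, Thm. 6.1 and Prop. 6.5 (PDF pp. 134–136). [LemarieRieusset2016]
-/

noncomputable section

open MeasureTheory TopologicalSpace Set Function Filter InnerProductSpace Metric
open _root_.Topology
open scoped RealInnerProductSpace ENNReal NNReal

namespace Literature.Analysis.FluidPDE

variable {E : Type*} [NormedAddCommGroup E] [InnerProductSpace ℝ E] [FiniteDimensional ℝ E]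
  [MeasurableSpace E] [BorelSpace E]

/-! ### The Duhamel pairing on a window below the caloric origin -/

section TimePairing

variable {ν T s t : ℝ} {φ : E → E} {a b : ℝ → E → E}

/-- **Measurability in time of the transport pairing on a window `(0, s)`, `s ≤ t`**:
`τ ↦ ∫ ⟪a(τ), D(e^{ν(t-τ)Δ}φ) b(τ)⟫` is a.e. strongly measurable on `(0, s)` for jointly
measurable `a, b` on `(0, T) × E`, `s ≤ T`, and a `C¹_c` test field `φ` (the tree's
`aestronglyMeasurable_transportPairing` is the case `s = t`; same proof: the operator field is
jointly continuous on `τ < t`, then `AEStronglyMeasurable.integral_prod_right'`). [folklore] -/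
theorem aestronglyMeasurable_transportPairing_of_le (hν : 0 < ν) (hφ : ContDiff ℝ 1 φ)
    (hc : HasCompactSupport φ) (hsT : s ≤ T) (hst : s ≤ t)
    (ha : AEStronglyMeasurable (uncurry a) ((volume : Measure (ℝ × E)).restrict (Ioo 0 T ×ˢ univ)))
    (hb : AEStronglyMeasurable (uncurry b) ((volume : Measure (ℝ × E)).restrict (Ioo 0 T ×ˢ univ))) :
    AEStronglyMeasurable
      (fun τ => ∫ x, ⟪a τ x, fderiv ℝ (heatTest ν φ (t - τ)) x (b τ x)⟫)
      (volume.restrict (Ioo 0 s)) := by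
  set μ : Measure (ℝ × E) := (volume.restrict (Ioo 0 s)).prod (volume : Measure E) with hμ
  have ha' := aestronglyMeasurable_uncurry_mono hsT ha
  have hb' := aestronglyMeasurable_uncurry_mono hsT hb
  -- the operator field is continuous on `τ < t`
  have hΨc : ContinuousOn (fun q : ℝ × E => fderiv ℝ (heatTest ν φ (t - q.1)) q.2)
      (Iio t ×ˢ univ) := by
    have hc2 : Continuous fun q : ℝ × E => ((t - q.1, q.2) : ℝ × E) := by fun_prop
    have h := ContinuousOn.comp (g := fun q : ℝ × E => fderiv ℝ (heatTest ν φ q.1) q.2)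
      (f := fun q : ℝ × E => ((t - q.1, q.2) : ℝ × E)) (s := Iio t ×ˢ univ)
      (continuousOn_fderiv_heatTest hν hφ hc) hc2.continuousOn
      (fun q hq => ⟨show (0 : ℝ) < t - q.1 from sub_pos.2 hq.1, mem_univ _⟩)
    simpa only [Function.comp_def] using h
  have hΨm : AEStronglyMeasurable (fun q : ℝ × E => fderiv ℝ (heatTest ν φ (t - q.1)) q.2) μ := by
    have hsub : Ioo 0 s ×ˢ (univ : Set E) ⊆ Iio t ×ˢ univ :=
      prod_mono (fun τ hτ => (hτ.2.trans_le hst : τ < t)) subset_rfl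
    have h := (hΨc.mono hsub).aestronglyMeasurable
      (μ := (volume : Measure (ℝ × E))) (measurableSet_Ioo.prod MeasurableSet.univ)
    rwa [volume_restrict_slab_eq_prod] at h
  have hH : AEStronglyMeasurable
      (fun q : ℝ × E => ⟪uncurry a q, fderiv ℝ (heatTest ν φ (t - q.1)) q.2 (uncurry b q)⟫) μ :=
    ha'.inner ((isBoundedBilinearMap_apply (𝕜 := ℝ) (E := E) (F := E)).continuous
      |>.comp_aestronglyMeasurable (hΨm.prodMk hb'))
  exact hH.integral_prod_right'

/-- **Interval integrability in time of the transport pairing on `[0, s]`, `s ≤ t`**, for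
`a, b` jointly measurable on `(0, T) × E`, `s ≤ T`, with `‖a(τ)‖_{L³} ≤ M_a`,
`‖b(τ)‖_{L³} ≤ M_b` on `[0, s]`: the pairing is measurable and bounded by `M_a ‖Dφ‖_{L³} M_b`
(`integral_inner_clm_apply_le`, `eLpNorm_fderiv_heatTest_le`; the tree's
`intervalIntegrable_transportPairing` is the case `s = t`). [folklore] -/
theorem intervalIntegrable_transportPairing_of_le (hν : 0 < ν) (hφ : ContDiff ℝ 1 φ)
    (hc : HasCompactSupport φ) (hs0 : 0 ≤ s) (hsT : s ≤ T) (hst : s ≤ t)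
    (ha : AEStronglyMeasurable (uncurry a) ((volume : Measure (ℝ × E)).restrict (Ioo 0 T ×ˢ univ)))
    (hb : AEStronglyMeasurable (uncurry b) ((volume : Measure (ℝ × E)).restrict (Ioo 0 T ×ˢ univ)))
    {Ma Mb : ℝ≥0∞} (hMa : Ma < ⊤) (hMb : Mb < ⊤)
    (ha3 : ∀ τ ∈ Icc 0 s, MemLp (a τ) 3 (volume : Measure E) ∧ eLpNorm (a τ) 3 volume ≤ Ma)
    (hb3 : ∀ τ ∈ Icc 0 s, MemLp (b τ) 3 (volume : Measure E) ∧ eLpNorm (b τ) 3 volume ≤ Mb) :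
    IntervalIntegrable
      (fun τ => ∫ x, ⟪a τ x, fderiv ℝ (heatTest ν φ (t - τ)) x (b τ x)⟫) volume 0 s := by
  rw [intervalIntegrable_iff_integrableOn_Ioc_of_le hs0, integrableOn_Ioc_iff_integrableOn_Ioo]
  have hDφ : MemLp (fderiv ℝ φ) 3 (volume : Measure E) :=
    (hφ.continuous_fderiv one_ne_zero).memLp_of_hasCompactSupport (hc.fderiv ℝ)
  set B : ℝ := (Ma * eLpNorm (fderiv ℝ φ) 3 volume * Mb).toReal with hB
  haveI : IsFiniteMeasure (volume.restrict (Ioo (0 : ℝ) s)) :=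
    isFiniteMeasure_restrict.2 measure_Ioo_lt_top.ne
  refine Integrable.mono' (integrable_const B)
    (aestronglyMeasurable_transportPairing_of_le hν hφ hc hsT hst ha hb) ?_
  refine (ae_restrict_iff' measurableSet_Ioo).2 (Eventually.of_forall fun τ hτ => ?_)
  have hτ' : τ ∈ Icc 0 s := ⟨hτ.1.le, hτ.2.le⟩
  have hΨ : MemLp (fderiv ℝ (heatTest ν φ (t - τ))) 3 (volume : Measure E) :=
    memLp_fderiv_heatTest hν (sub_nonneg.2 (hτ.2.le.trans hst)) hφ hc (by norm_num)
  have h := (integral_inner_clm_apply_le (ha3 τ hτ').1 (hb3 τ hτ').1 hΨ).2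
  rw [Real.norm_eq_abs]
  refine h.trans (ENNReal.toReal_mono ?_ ?_)
  · exact (ENNReal.mul_lt_top (ENNReal.mul_lt_top hMa hDφ.2) hMb).ne
  · gcongr
    · exact (ha3 τ hτ').2
    · exact eLpNorm_fderiv_heatTest_le hν (sub_nonneg.2 (hτ.2.le.trans hst)) hφ hc (by norm_num)
    · exact (hb3 τ hτ').2

end TimePairing

/-! ### The identity against caloric tests -/

section Caloric

variable {ν T : ℝ} {u₀ : E → E} {v : ℝ → E → E}

/-- **Mild `C([0,T); L³)` solutions tested against caloric fields** (Fabes–Jones–Rivière 1972,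
Thm. 2.1; Lemarié-Rieusset 2016, Thm. 6.1 with Prop. 6.5). On a three-dimensional space, let
`ν > 0`, `u₀ ∈ L³`, and let `v` be an unforced mild solution on `[0, T)` from `u₀` in the
duality form, with `v ∈ C([0,T); L³)` and `v` jointly measurable on `(0,T) × E`. Then for
`s ∈ [0, T)`, `σ ≥ 0` and every smooth compactly supported divergence-free `φ`,
`∫⟪v(s), e^{νσΔ}φ⟫ = ∫⟪u₀, e^{ν(s+σ)Δ}φ⟫ + ∫₀ˢ ∫⟪v(τ), (v(τ)·∇) e^{ν(s+σ-τ)Δ}φ⟫ dτ`.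
At `σ = 0` this is the definition; for `σ > 0` the identity at time `s` is tested with the
solenoidal truncations `Ψ_R` of `ψ = e^{νσΔ}φ` and `R → ∞` ("Step A" of
`IsMildNSSolutionOn.isMildNSSolutionBetween_of_continuousInLpOn_three`, with the semigroup law
`e^{νrΔ}ψ = e^{ν(σ+r)Δ}φ`; nothing requires `s + σ < T`). [cite: FabesJonesRiviere1972, Thm. 2.1] [cite: LemarieRieusset2016, Thm. 6.1 and Prop. 6.5 (PDF pp. 134–136)] -/
theorem IsMildNSSolutionOn.integral_inner_heatTest_eq_of_continuousInLpOn_three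
    (hE : Module.finrank ℝ E = 3) (hν : 0 < ν) (hu₀ : MemLp u₀ 3 volume)
    (hv : IsMildNSSolutionOn (Ico 0 T) ν 0 u₀ v) (hvc : ContinuousInLpOn (Ico 0 T) 3 v)
    (hmeas : AEStronglyMeasurable (uncurry v) (volume.restrict (Ioo 0 T ×ˢ univ)))
    {s σ : ℝ} (hs : s ∈ Ico 0 T) (hσ : 0 ≤ σ) {φ : E → E}
    (hφ : FunctionSpaces.IsTestFunctionOn (⊤ : Opens E) φ) (hdiv : VectorCalculus.IsDivFree φ) :
    ∫ x, ⟪v s x, heatTest ν φ σ x⟫ = (∫ x, ⟪u₀ x, heatTest ν φ (s + σ) x⟫) +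
      ∫ τ in 0..s, ∫ x, ⟪v τ x, convect (v τ) (heatTest ν φ (s + σ - τ)) x⟫ := by
  -- `σ = 0`: the definition
  rcases hσ.eq_or_lt with h0 | hσpos
  · subst h0
    have h := hv.2 s hs φ hφ hdiv
    simpa only [heatTest_zero_right, add_zero, Pi.zero_apply, inner_zero_left, integral_zero,
      intervalIntegral.integral_zero] using h
  haveI : ENNReal.HolderTriple 3 (3 / 2) 1 := holderTriple_three_threeHalves_one
  have h32le : (1 : ℝ≥0∞) ≤ 3 / 2 := by
    rw [ENNReal.le_div_iff_mul_le (Or.inl two_ne_zero) (Or.inl ENNReal.ofNat_ne_top)]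
    norm_num
  have hφ1 : ContDiff ℝ 1 φ := hφ.contDiff.of_le (by exact_mod_cast le_top)
  have hφc : HasCompactSupport φ := hφ.hasCompactSupport
  have hφp : ∀ p : ℝ≥0∞, MemLp φ p volume := fun p =>
    hφ.contDiff.continuous.memLp_of_hasCompactSupport hφc
  -- the caloric test field `ψ = e^{νσΔ}φ`
  have ha : 0 < ν * σ := mul_pos hν hσpos
  set ψ : E → E := heatTest ν φ σ with hψ_def
  have hψ_eq : ψ = UnboundedOperators.heatExtension φ (ν * σ) := heatTest_of_pos hν hσpos φ
  have hψ_smooth : ContDiff ℝ ((⊤ : ℕ∞) : WithTop ℕ∞) ψ := contDiff_heatFlow hφ.contDiff hφc _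
  have hψ_div : VectorCalculus.IsDivFree ψ := isDivFree_heatFlow hφ1 hφc hdiv _
  have hψ_mem : ∀ p : ℝ≥0∞, 1 ≤ p → MemLp ψ p volume := fun p hp =>
    memLp_heatFlow_holds (hφp p) hp ha.le
  obtain ⟨Cψ, hCψ0, hCψ⟩ : ∃ C : ℝ, 0 ≤ C ∧ ∀ y, (1 + ‖y‖) ^ 3 * ‖ψ y‖ ≤ C := by
    rw [hψ_eq]
    exact exists_weight_pow_mul_norm_heatExtension_le hφ.contDiff.continuous hφc ha 3
  -- the semigroup law: `e^{νrΔ}ψ = e^{ν(σ+r)Δ}φ`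
  have hsemi : ∀ r : ℝ, 0 ≤ r → heatTest ν ψ r = heatTest ν φ (σ + r) := by
    intro r hr
    change heatFlow (heatFlow φ (ν * σ)) (ν * r) = heatFlow φ (ν * (σ + r))
    rw [heatFlow_heatFlow_holds (hφp 2) (by norm_num) ha.le (mul_nonneg hν.le hr)]
    congr 1
    ring
  -- uniform `L³` bound of `v` on `[0, s]`
  obtain ⟨M, hM⟩ := ContinuousInLpOn.exists_forall_eLpNorm_le hvc (by norm_num) isCompact_Icc
    (show Icc 0 s ⊆ Ico 0 T from fun τ hτ => ⟨hτ.1, hτ.2.trans_lt hs.2⟩)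
  -- the nonlinear integrand with the test `φ` and caloric origin `s + σ`
  set N : ℝ → ℝ := fun τ => ∫ x, ⟪v τ x, convect (v τ) (heatTest ν φ (s + σ - τ)) x⟫ with hN
  have hN_int : IntervalIntegrable N volume 0 s := by
    have h := intervalIntegrable_transportPairing_of_le hν hφ1 hφc hs.1 hs.2.le
      (by linarith : s ≤ s + σ) hmeas hmeas
      (ENNReal.coe_lt_top (r := M)) (ENNReal.coe_lt_top (r := M))
      (fun τ hτ => ⟨hvc.1 τ ⟨hτ.1, hτ.2.trans_lt hs.2⟩, hM τ hτ⟩)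
      (fun τ hτ => ⟨hvc.1 τ ⟨hτ.1, hτ.2.trans_lt hs.2⟩, hM τ hτ⟩)
    simpa only [hN, convect] using h
  -- the truncations are admissible tests
  have hR_test : ∀ R : ℝ, 0 < R →
      FunctionSpaces.IsTestFunctionOn (⊤ : Opens E) (solenoidalTruncation ψ R) := fun R hR =>
    isTestFunctionOn_solenoidalTruncation hψ_smooth hR
  have hR_div : ∀ R : ℝ, VectorCalculus.IsDivFree (solenoidalTruncation ψ R) := fun R =>
    isDivFree_solenoidalTruncation hE (hψ_smooth.of_le (by exact_mod_cast le_top)) hψ_div R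
  have hR_mem : ∀ R : ℝ, 0 < R → ∀ p : ℝ≥0∞, MemLp (solenoidalTruncation ψ R) p volume :=
    fun R hR p => (hR_test R hR).contDiff.continuous.memLp_of_hasCompactSupport
      (hasCompactSupport_solenoidalTruncation hR)
  -- the identity at time `s` with the test `Ψ_R`
  set NR : ℝ → ℝ → ℝ := fun R τ =>
    ∫ x, ⟪v τ x, convect (v τ) (heatTest ν (solenoidalTruncation ψ R) (s - τ)) x⟫ with hNR
  have hIdR : ∀ R : ℝ, 0 < R → ∫ x, ⟪v s x, solenoidalTruncation ψ R x⟫ =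
      (∫ x, ⟪u₀ x, heatTest ν (solenoidalTruncation ψ R) s x⟫) + ∫ τ in 0..s, NR R τ := by
    intro R hR
    have h := hv.2 s hs _ (hR_test R hR) (hR_div R)
    simpa only [Pi.zero_apply, inner_zero_left, integral_zero, intervalIntegral.integral_zero,
      add_zero] using h
  -- (a) the left-hand sides converge
  have hLa : Tendsto (fun R : ℝ => ∫ x, ⟪v s x, solenoidalTruncation ψ R x⟫) atTop
      (𝓝 (∫ x, ⟪v s x, ψ x⟫)) :=
    tendsto_integral_inner_solenoidalTruncation hE hψ_smooth hCψ (hψ_mem _ h32le) (hvc.1 s hs)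
  -- (b) the datum terms converge
  have hLb : Tendsto (fun R : ℝ => ∫ x, ⟪u₀ x, heatTest ν (solenoidalTruncation ψ R) s x⟫) atTop
      (𝓝 (∫ x, ⟪u₀ x, heatTest ν φ (s + σ) x⟫)) := by
    set f₀ : E → E := heatFlow u₀ (ν * s) with hf₀_def
    have hf₀ : MemLp f₀ 3 volume := memLp_heatFlow_holds hu₀ (by norm_num) (mul_nonneg hν.le hs.1)
    have hsymm : ∀ g : E → E, MemLp g (3 / 2) volume →
        ∫ x, ⟪u₀ x, heatTest ν g s x⟫ = ∫ x, ⟪f₀ x, g x⟫ := by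
      intro g hg
      change ∫ x, ⟪u₀ x, heatFlow g (ν * s) x⟫ = ∫ x, ⟪heatFlow u₀ (ν * s) x, g x⟫
      rcases (mul_nonneg hν.le hs.1).eq_or_lt with h0 | hpos
      · rw [← h0, heatFlow_zero, heatFlow_zero]
      · rw [heatFlow_of_pos _ hpos, heatFlow_of_pos _ hpos]
        exact integral_inner_heatExtension_comm hu₀ hg hpos
    have h2 : ∫ x, ⟪u₀ x, heatTest ν φ (s + σ) x⟫ = ∫ x, ⟪f₀ x, ψ x⟫ := by
      rw [← hsymm ψ (hψ_mem _ h32le), hsemi s hs.1]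
      congr 1
      funext x
      congr 2
      ring
    rw [h2]
    refine (tendsto_integral_inner_solenoidalTruncation hE hψ_smooth hCψ
      (hψ_mem _ h32le) hf₀).congr' ?_
    filter_upwards [eventually_gt_atTop 0] with R hR
    exact (hsymm _ (hR_mem R hR _)).symm
  -- (c) the nonlinear terms converge
  have hLc : Tendsto (fun R : ℝ => ∫ τ in 0..s, NR R τ) atTop (𝓝 (∫ τ in 0..s, N τ)) := by
    have hNR_int : ∀ R : ℝ, 0 < R → IntervalIntegrable (NR R) volume 0 s := by
      intro R hR
      have h := intervalIntegrable_transportPairing hν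
        ((hR_test R hR).contDiff.of_le (by exact_mod_cast le_top))
        (hasCompactSupport_solenoidalTruncation hR) hs.1 hs.2.le hmeas hmeas
        (ENNReal.coe_lt_top (r := M)) (ENNReal.coe_lt_top (r := M))
        (fun τ hτ => ⟨hvc.1 τ ⟨hτ.1, hτ.2.trans_lt hs.2⟩, hM τ hτ⟩)
        (fun τ hτ => ⟨hvc.1 τ ⟨hτ.1, hτ.2.trans_lt hs.2⟩, hM τ hτ⟩)
      simpa only [hNR, convect] using h
    -- the gradient smoothing constant, `p = q = 3`
    obtain ⟨Cg, hCg⟩ := UnboundedOperators.eLpNorm_fderiv_heatExtension_le_rpow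
      (E := E) (F := E) (p := 3) (q := 3) (by norm_num) le_rfl
    have hCg' : ∀ g : E → E, MemLp g 3 volume → ∀ r : ℝ, 0 < r →
        eLpNorm (fderiv ℝ (UnboundedOperators.heatExtension g r)) 3 volume ≤
          Cg * ENNReal.ofReal (r ^ (-(1 / 2 : ℝ))) * eLpNorm g 3 volume := by
      intro g hg r hr
      have h := hCg g hg r hr
      simp only [sub_self, mul_zero, sub_zero] at h
      exact h
    -- the truncation error in `L³`
    set d : ℝ → ℝ≥0∞ := fun R => eLpNorm (fun x => solenoidalTruncation ψ R x - ψ x) 3 volume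
      with hd_def
    have hd_top : ∀ R : ℝ, 0 < R → d R ≠ ⊤ := fun R hR =>
      ((hR_mem R hR 3).sub (hψ_mem 3 (by norm_num))).2.ne
    have hd_lim : Tendsto d atTop (𝓝 0) :=
      tendsto_eLpNorm_solenoidalTruncation_sub hE hψ_smooth hCψ (hψ_mem 3 (by norm_num))
    -- pointwise-in-time bound of the difference of the nonlinear integrands
    set K : ℝ := (M : ℝ) ^ 2 * Cg * ν ^ (-(1 / 2 : ℝ)) with hK
    have hK0 : 0 ≤ K := by positivity
    have hbdτ : ∀ R : ℝ, 0 < R → ∀ τ ∈ Ioo 0 s,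
        ‖NR R τ - N τ‖ ≤ K * (s - τ) ^ (-(1 / 2 : ℝ)) * (d R).toReal := by
      intro R hR τ hτ
      have hτT : τ ∈ Ico 0 T := ⟨hτ.1.le, hτ.2.trans hs.2⟩
      have hv3 : MemLp (v τ) 3 volume := hvc.1 τ hτT
      have hvM : eLpNorm (v τ) 3 volume ≤ M := hM τ ⟨hτ.1.le, hτ.2.le⟩
      have hστ : 0 < s - τ := sub_pos.2 hτ.2
      have hr : 0 < ν * (s - τ) := mul_pos hν hστ
      set ΨR : E → E →L[ℝ] E := fderiv ℝ (heatTest ν (solenoidalTruncation ψ R) (s - τ))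
        with hΨR
      set Ψ : E → E →L[ℝ] E := fderiv ℝ (heatTest ν φ (s + σ - τ)) with hΨ
      have hΨR3 : MemLp ΨR 3 volume :=
        memLp_fderiv_heatTest hν hστ.le ((hR_test R hR).contDiff.of_le (by exact_mod_cast le_top))
          (hasCompactSupport_solenoidalTruncation hR) (by norm_num)
      have hΨ3 : MemLp Ψ 3 volume :=
        memLp_fderiv_heatTest hν (by linarith) hφ1 hφc (by norm_num)
      -- the difference of the operator fields is the gradient of `e^{ν(s-τ)Δ}(Ψ_R - ψ)`
      have hgR : heatTest ν (solenoidalTruncation ψ R) (s - τ) =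
          UnboundedOperators.heatExtension (solenoidalTruncation ψ R) (ν * (s - τ)) :=
        heatTest_of_pos hν hστ _
      have hgψ : heatTest ν φ (s + σ - τ) = UnboundedOperators.heatExtension ψ (ν * (s - τ)) := by
        have h1 : heatTest ν φ (s + σ - τ) = heatTest ν ψ (s - τ) := by
          rw [hsemi (s - τ) hστ.le]; congr 1; ring
        rw [h1]
        exact heatTest_of_pos hν hστ _
      have hdiffeq : (fun x => ΨR x - Ψ x) = fderiv ℝ (UnboundedOperators.heatExtension
          (fun y => solenoidalTruncation ψ R y - ψ y) (ν * (s - τ))) := by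
        have hsub : UnboundedOperators.heatExtension (fun y => solenoidalTruncation ψ R y - ψ y)
            (ν * (s - τ)) = UnboundedOperators.heatExtension (solenoidalTruncation ψ R)
              (ν * (s - τ)) - UnboundedOperators.heatExtension ψ (ν * (s - τ)) :=
          heatExtension_sub_eq_of_memLp (hR_mem R hR 3) (hψ_mem 3 (by norm_num)) (by norm_num) hr
        have hd1 : Differentiable ℝ (UnboundedOperators.heatExtension (solenoidalTruncation ψ R)
            (ν * (s - τ))) :=
          (UnboundedOperators.contDiff_heatExtension_holds (hR_mem R hR 3) (by norm_num) hr).differentiable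
            (by simp)
        have hd2 : Differentiable ℝ (UnboundedOperators.heatExtension ψ (ν * (s - τ))) :=
          (UnboundedOperators.contDiff_heatExtension_holds (hψ_mem 3 (by norm_num)) (by norm_num) hr).differentiable
            (by simp)
        rw [hsub]
        funext x
        rw [hΨR, hΨ, hgR, hgψ, fderiv_sub (hd1 x) (hd2 x)]
      -- the difference of the nonlinear terms as one integral
      have hi1 := (integral_inner_clm_apply_le hv3 hv3 hΨR3).1
      have hi2 := (integral_inner_clm_apply_le hv3 hv3 hΨ3).1
      have hsub : NR R τ - N τ = ∫ x, ⟪v τ x, (ΨR x - Ψ x) (v τ x)⟫ := by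
        simp only [hNR, hN, convect]
        rw [← integral_sub hi1 hi2]
        refine integral_congr_ae (Eventually.of_forall fun x => ?_)
        simp only [FunLike.coe_sub, Pi.sub_apply, inner_sub_right, hΨR, hΨ]
      have hD3 : MemLp (fun x => ΨR x - Ψ x) 3 volume := hΨR3.sub hΨ3
      have hbound := (integral_inner_clm_apply_le hv3 hv3 hD3).2
      have hgrad : eLpNorm (fun x => ΨR x - Ψ x) 3 volume ≤
          Cg * ENNReal.ofReal ((ν * (s - τ)) ^ (-(1 / 2 : ℝ))) * d R := by
        rw [hdiffeq]
        exact hCg' _ ((hR_mem R hR 3).sub (hψ_mem 3 (by norm_num))) _ hr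
      have hfin : (M : ℝ≥0∞) * (Cg * ENNReal.ofReal ((ν * (s - τ)) ^ (-(1 / 2 : ℝ))) * d R) * M ≠ ⊤ :=
        ENNReal.mul_ne_top (ENNReal.mul_ne_top ENNReal.coe_ne_top
          (ENNReal.mul_ne_top (ENNReal.mul_ne_top ENNReal.coe_ne_top ENNReal.ofReal_ne_top)
            (hd_top R hR))) ENNReal.coe_ne_top
      rw [Real.norm_eq_abs, hsub]
      refine hbound.trans ?_
      have hle : eLpNorm (v τ) 3 volume * eLpNorm (fun x => ΨR x - Ψ x) 3 volume *
          eLpNorm (v τ) 3 volume ≤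
          (M : ℝ≥0∞) * (Cg * ENNReal.ofReal ((ν * (s - τ)) ^ (-(1 / 2 : ℝ))) * d R) * M :=
        mul_le_mul' (mul_le_mul' hvM hgrad) hvM
      refine (ENNReal.toReal_mono hfin hle).trans (le_of_eq ?_)
      have hνst : (ν * (s - τ)) ^ (-(1 / 2 : ℝ)) = ν ^ (-(1 / 2 : ℝ)) * (s - τ) ^ (-(1 / 2 : ℝ)) :=
        Real.mul_rpow hν.le hστ.le
      rw [ENNReal.toReal_mul, ENNReal.toReal_mul, ENNReal.toReal_mul, ENNReal.toReal_mul,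
        ENNReal.toReal_ofReal (by positivity), ENNReal.coe_toReal, ENNReal.coe_toReal, hνst, hK]
      ring
    -- the bound is integrable on `(0, s)`
    have hb_int : IntervalIntegrable (fun τ : ℝ => K * (s - τ) ^ (-(1 / 2 : ℝ))) volume 0 s := by
      have h := (intervalIntegral.intervalIntegrable_rpow' (a := 0) (b := s) (r := -(1 / 2 : ℝ))
        (by norm_num)).comp_sub_left s
      simp only [sub_zero, sub_self] at h
      exact (h.symm).const_mul K
    -- hence the integrals differ by `≤ (∫ K (s-τ)^{-1/2}) ‖Ψ_R - ψ‖₃ → 0`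
    have hdiffint : ∀ᶠ R : ℝ in atTop, ‖(∫ τ in 0..s, NR R τ) - ∫ τ in 0..s, N τ‖ ≤
        (∫ τ in 0..s, K * (s - τ) ^ (-(1 / 2 : ℝ))) * (d R).toReal := by
      filter_upwards [eventually_gt_atTop 0] with R hR
      rw [← intervalIntegral.integral_sub (hNR_int R hR) hN_int,
        ← intervalIntegral.integral_mul_const]
      refine intervalIntegral.norm_integral_le_of_norm_le hs.1 ?_ (hb_int.mul_const _)
      have hne : ∀ᵐ τ : ℝ ∂volume, τ ≠ s := by
        have h : volume ({s} : Set ℝ) = 0 := Real.volume_singleton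
        exact measure_eq_zero_iff_ae_notMem.1 h
      filter_upwards [hne] with τ hτs hτ
      exact hbdτ R hR τ ⟨hτ.1, lt_of_le_of_ne hτ.2 hτs⟩
    have hlim0 : Tendsto (fun R : ℝ => (∫ τ in 0..s, K * (s - τ) ^ (-(1 / 2 : ℝ))) * (d R).toReal)
        atTop (𝓝 0) := by
      have h1 := (ENNReal.tendsto_toReal ENNReal.zero_ne_top).comp hd_lim
      rw [ENNReal.toReal_zero] at h1
      have h2 := h1.const_mul (∫ τ in 0..s, K * (s - τ) ^ (-(1 / 2 : ℝ)))
      rwa [mul_zero] at h2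
    rw [tendsto_iff_norm_sub_tendsto_zero]
    exact squeeze_zero' (Eventually.of_forall fun _ => norm_nonneg _) hdiffint hlim0
  -- combine (a), (b), (c) with the identities at time `s`
  have hsum := hLb.add hLc
  have hLa' : Tendsto (fun R : ℝ => ∫ x, ⟪v s x, solenoidalTruncation ψ R x⟫) atTop
      (𝓝 ((∫ x, ⟪u₀ x, heatTest ν φ (s + σ) x⟫) + ∫ τ in 0..s, N τ)) :=
    hsum.congr' (by
      filter_upwards [eventually_gt_atTop 0] with R hR
      exact (hIdR R hR).symm)
  exact tendsto_nhds_unique hLa hLa'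

end Caloric

end Literature.Analysis.FluidPDE

end
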